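import Mathlib.Algebra.BigOperators.Fin
import Mathlib.Algebra.Order.BigOperators.Group.Finset
import Literature.Combinatorics.Sahi2008.TotalOrder
import HarnessLib

/-!
# Richards (2004), §5 "Applications": the third-order Bernstein-polynomial and Chebyshev-type inequalities
# (Props. 5.1, 5.2) PROVED, and the status of Prop. 5.3 (`= C₃` for the uniform measure)

Topic `Literature/Combinatorics/Sahi2008` (companion of `ConjugateCumulants.lean`, `RichardsInduction.lean`,
`RichardsIndicatorMethod.lean`, `TotalOrder.lean`).

## Source, verbatim

D. St. P. Richards, *Algebraic methods toward higher-order probability inequalities, II*, Ann. Probab. **32** (2004)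
1509–1544 [Richards2004], §5, pp. 1530–1532 (Project Euclid copy, corpus `paper:url-a35428b45c2b`, p0022–p0024):

"5.1. *Generalized inequalities for Bernstein polynomials.* For `f ∈ C[0,1]`, the Bernstein polynomial of `f` is
the polynomial defined on `[0,1]` by `B_n f(x) = Σ_{k=0}^{n} f(k/n) (n choose k) x^k (1 − x)^{n−k}`. Generalizing
Theorem 2.6 of Seymour and Welsh (1975), we have the following result.
**PROPOSITION 5.1.** If `f₁, f₂` and `f₃` are nonnegative increasing functions on `[0,1]`, then their Bernstein
polynomials satisfy `2B_n(f₁f₂f₃)(x) − [B_n(f₁f₂)(x) B_n f₃(x) + B_n(f₁f₃)(x) B_n f₂(x) + B_n f₁(x) B_n(f₂f₃)(x)]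
+ B_n f₁(x) B_n f₂(x) B_n f₃(x) ≥ 0` (5.1) for all `x ∈ [0,1]`.  PROOF. Let `A` be a set of `n` elements and let
`x ∈ [0,1]`. Define a probability measure `µ` on the lattice `2^A` by `µ(a) = c x^{card(a)}(1 − x)^{n−card(a)}` …
Next we define `f̂_j(a) = f_j(card(a)/n)` … On applying Theorem 1.1 to the probability measure `µ` and the
functions `f̂_j`, `j = 1,2,3`, we obtain (5.1). □"
"5.2. *Inequalities for log-convex sequences.* … `⟨{α_k}⟩ := Σ_{k=0}^{n} α_k`. The following result extends
Theorem 3.2 of Seymour and Welsh (1975), which itself is a generalization of a classical inequality of Tchebycheff.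
**PROPOSITION 5.2.** Suppose that `{a₀,…,a_n}` is a positive, log-convex sequence with `⟨{a_k}⟩ = 1`. Suppose also
that the sequences `{α₀,…,α_n}`, `{β₀,…,β_n}` and `{γ₀,…,γ_n}` are increasing and nonnegative. Then
`2⟨{a_kα_kβ_kγ_k}⟩ − ⟨{a_kα_kβ_k}⟩⟨{a_kγ_k}⟩ − ⟨{a_kα_kγ_k}⟩⟨{a_kβ_k}⟩ − ⟨{a_kα_k}⟩⟨{a_kβ_kγ_k}⟩ +
⟨{a_kα_k}⟩⟨{a_kβ_k}⟩⟨{a_kγ_k}⟩ ≥ 0` (5.2).  PROOF. … On applying Theorem 1.1 to the probability measure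
proportional to `µ` and the functions `f_j` … □"
"5.3. *A generalization of Kleitman's lemma.* … **PROPOSITION 5.3.** Let `A` be a finite set of cardinality `n`,
and let `U₁, U₂`, and `L` be collections of subsets of `A`. Suppose that `U₁` and `U₂` are closed above and `L` is
closed below. Then `2^{2n} card(U₁ ∩ U₂) − 2^{2n+1} card(U₁ ∩ U₂ ∩ L) + 2^n (card(U₁ ∩ U₂) card(L) +
card(U₁ ∩ L) card(U₂) + card(U₁) card(U₂ ∩ L)) − 2^n card(U₁) card(U₂) − card(U₁) card(U₂) card(L) ≥ 0`
(5.4).  PROOF. Let `µ` be the uniform distribution on `2^A` … let `f₃` denote the characteristic function of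
`L^c` … (5.4) is obtained by applying Theorem 1.1 to the measure `µ` and the functions `f₁, f₂` and `1 − f₃`
[sic]. □"

## Status, and what is formalised

All three printed proofs invoke Richards' Theorem 1.1 (`κ′₃ ≥ 0` for MTP₂ measures on finite distributive
lattices), whose printed proof is regarded as incomplete ([LiebSahi2021, p. 3]; `RichardsInduction.lean`), and
which is, weight by weight, Sahi's conjecture `C₃` (`forall_conjCumulant_nonneg_iff_sahiPositive`).  Nevertheless:
* **Proposition 5.2 is TRUE, and for EVERY nonnegative sequence `a` with sum `1`** (log-convexity is not needed):
  the index set `{0,…,n}` is a chain, and on a finite chain Sahi's inequalities of every order hold for every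
  probability weight (Blinovsky 2013, Lemma 1 — the tree's `sahiPositive_of_linearOrder`, `TotalOrder.lean`);
  (5.2) is `E₃(α,β,γ) ≥ 0` for the weight `a`.  `richards2004_prop52` (any finite linear order as index set).
* **Proposition 5.1 is TRUE**: `B_n g(x) = E[g(K/n)]` for `K ∼ Bin(n,x)`, a probability weight on the chain
  `{0,…,n}`, and `k ↦ f_j(k/n)` is nonnegative increasing; so (5.1) is again the chain case at order 3.
  `bernsteinPoly` (the displayed `B_n f(x)`), `richards2004_prop51`.  (Richards' own route — functions of
  `card(a)` on `2^A` under `µ_x` — is the push-forward to this chain.)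
* **Proposition 5.3 is, verbatim, Sahi's `C₃` for the UNIFORM measure on `2^A`** (three increasing events
  `U₁, U₂, L^c`): `richards2004_display54_eq` shows `LHS(5.4) = 2^{3n} · E₃(1_{U₁}, 1_{U₂}, 1_{L^c})` under the
  uniform weight, for ALL families `U₁, U₂, L` (an identity; no closure hypothesis on the families is used).  Hence
  Prop. 5.3 for all `n` is equivalent to Kahn's Conjecture 5 for fair coins (Gladkov–Zimin's Conjecture 2.6),
  which is OPEN in print; the tree proves it for `n ≤ 4` coordinates (`sahiC3_cube_le_three`, kernel;
  `sahiC3_cube_four`, certified) and nothing here asserts it.  Recorded as a printed claim whose printed proof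
  depends on the gap.

## References
* D. St. P. Richards, Ann. Probab. 32 (2004) 1509–1544, §5 Props. 5.1–5.3, pp. 1530–1532. [Richards2004]
* P. D. Seymour, D. J. A. Welsh, *Combinatorial applications of an inequality from statistical mechanics*,
  Math. Proc. Cambridge Philos. Soc. 77 (1975) 485–495, Thms. 2.6, 3.2, 4.2 (the second-order originals, as
  cited by Richards).
* V. Blinovsky, *Correlation inequality for formal series*, CRM Series 16 (2013) 397–400, Lemma 1. [Blinovsky2013FormalSeries]
-/

noncomputable section

namespace Literature.Combinatorics.Sahi2008

namespace Richards2004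

open Finset

/-! ### Proposition 5.2 — the third-order Chebyshev/Seymour–Welsh inequality, for every probability sequence -/

/-- **Richards 2004, Proposition 5.2 (third-order Chebyshev inequality), proved — and without log-convexity.**
For a nonnegative weight `a` with `Σ a_k = 1` on a finite totally ordered index set and nonnegative increasing
`α, β, γ`:
`2⟨aαβγ⟩ − ⟨aαβ⟩⟨aγ⟩ − ⟨aαγ⟩⟨aβ⟩ − ⟨aα⟩⟨aβγ⟩ + ⟨aα⟩⟨aβ⟩⟨aγ⟩ ≥ 0`, `⟨f⟩ = Σ_k f_k` — display (5.2).
The printed hypothesis "`{a_k}` log-convex" (used there only to invoke Theorem 1.1) is superfluous: the index set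
is a chain, where Sahi's inequalities of every order hold for every probability weight
(`sahiPositive_of_linearOrder`). [cite: Richards2004, Prop. 5.2 (p. 1531); Blinovsky2013FormalSeries, Lemma 1] -/
theorem richards2004_prop52 {ι : Type*} [Fintype ι] [LinearOrder ι] {a α β γ : ι → ℝ}
    (ha : ∀ k, 0 ≤ a k) (ha1 : ∑ k, a k = 1) (hα : ∀ k, 0 ≤ α k) (hβ : ∀ k, 0 ≤ β k) (hγ : ∀ k, 0 ≤ γ k)
    (hαm : Monotone α) (hβm : Monotone β) (hγm : Monotone γ) :
    0 ≤ 2 * ∑ k, a k * (α k * β k * γ k) - (∑ k, a k * (α k * β k)) * (∑ k, a k * γ k)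
        - (∑ k, a k * (α k * γ k)) * (∑ k, a k * β k) - (∑ k, a k * α k) * (∑ k, a k * (β k * γ k))
        + (∑ k, a k * α k) * (∑ k, a k * β k) * (∑ k, a k * γ k) := by
  have h := sahiPositive_of_linearOrder ha ha1 3 ![α, β, γ]
    (fun i k => by fin_cases i <;> simp [hα, hβ, hγ])
    (fun i => by fin_cases i <;> simpa)
  rw [sahiE_three] at h
  simp only [ex_def, Pi.mul_apply] at h
  linarith

/-! ### Proposition 5.1 — the third-order Seymour–Welsh inequality for Bernstein polynomials -/

/-- The Bernstein polynomial `B_n f(x) = Σ_{k=0}^{n} f(k/n) (n choose k) x^k (1 − x)^{n−k}` (as displayed; the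
sum written over `k : Fin (n+1)`). [cite: Richards2004, §5.1 (p. 1530)] -/
def bernsteinPoly (n : ℕ) (f : ℝ → ℝ) (x : ℝ) : ℝ :=
  ∑ k : Fin (n + 1), ((n.choose k : ℝ) * x ^ (k : ℕ) * (1 - x) ^ (n - k)) * f ((k : ℕ) / n)

/-- Unfolding `bernsteinPoly`. [cite: Richards2004, §5.1 (p. 1530)] -/
theorem bernsteinPoly_def (n : ℕ) (f : ℝ → ℝ) (x : ℝ) :
    bernsteinPoly n f x =
      ∑ k : Fin (n + 1), ((n.choose k : ℝ) * x ^ (k : ℕ) * (1 - x) ^ (n - k)) * f ((k : ℕ) / n) := rfl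

/-- The binomial weights `(n choose k) x^k (1−x)^{n−k}`, `k = 0,…,n`, sum to `1`.
[cite: Richards2004, §5.1 (p. 1530), "a probability measure µ on the lattice 2^A"] -/
theorem sum_binomialWeight (n : ℕ) (x : ℝ) :
    ∑ k : Fin (n + 1), (n.choose k : ℝ) * x ^ (k : ℕ) * (1 - x) ^ (n - k) = 1 := by
  have h := add_pow x (1 - x) n
  rw [show x + (1 - x) = 1 by ring, one_pow] at h
  rw [Fin.sum_univ_eq_sum_range (fun k => (n.choose k : ℝ) * x ^ k * (1 - x) ^ (n - k)) (n + 1)]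
  calc ∑ k ∈ Finset.range (n + 1), (n.choose k : ℝ) * x ^ k * (1 - x) ^ (n - k)
      = ∑ k ∈ Finset.range (n + 1), x ^ k * (1 - x) ^ (n - k) * (n.choose k : ℝ) :=
        Finset.sum_congr rfl fun k _ => by ring
    _ = 1 := h.symm

/-- **Richards 2004, Proposition 5.1 (third-order Seymour–Welsh inequality for Bernstein polynomials), proved.**
If `f₁, f₂, f₃` are nonnegative and increasing on `[0,1]`, then for every `x ∈ [0,1]`
`2B_n(f₁f₂f₃)(x) − [B_n(f₁f₂)(x)B_nf₃(x) + B_n(f₁f₃)(x)B_nf₂(x) + B_nf₁(x)B_n(f₂f₃)(x)] + B_nf₁(x)B_nf₂(x)B_nf₃(x)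
≥ 0` — display (5.1).  Proof: `B_n g(x) = E[g(K/n)]`, `K ∼ Bin(n,x)` a probability weight on the chain
`{0,…,n}`, where Sahi's `E₃ ≥ 0` holds for every weight (`sahiPositive_of_linearOrder`); the printed proof
invokes Theorem 1.1 instead. [cite: Richards2004, Prop. 5.1 (p. 1530); Blinovsky2013FormalSeries, Lemma 1] -/
theorem richards2004_prop51 (n : ℕ) {f₁ f₂ f₃ : ℝ → ℝ}
    (h₁ : ∀ t ∈ Set.Icc (0 : ℝ) 1, 0 ≤ f₁ t) (h₂ : ∀ t ∈ Set.Icc (0 : ℝ) 1, 0 ≤ f₂ t)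
    (h₃ : ∀ t ∈ Set.Icc (0 : ℝ) 1, 0 ≤ f₃ t) (hm₁ : MonotoneOn f₁ (Set.Icc 0 1))
    (hm₂ : MonotoneOn f₂ (Set.Icc 0 1)) (hm₃ : MonotoneOn f₃ (Set.Icc 0 1)) {x : ℝ}
    (hx : x ∈ Set.Icc (0 : ℝ) 1) :
    0 ≤ 2 * bernsteinPoly n (f₁ * f₂ * f₃) x
        - (bernsteinPoly n (f₁ * f₂) x * bernsteinPoly n f₃ x + bernsteinPoly n (f₁ * f₃) x * bernsteinPoly n f₂ x
            + bernsteinPoly n f₁ x * bernsteinPoly n (f₂ * f₃) x)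
        + bernsteinPoly n f₁ x * bernsteinPoly n f₂ x * bernsteinPoly n f₃ x := by
  -- the binomial weight on the chain `Fin (n+1)` and the sampled functions `k ↦ f_j(k/n)`
  set w : Fin (n + 1) → ℝ := fun k => (n.choose k : ℝ) * x ^ (k : ℕ) * (1 - x) ^ (n - k) with hw
  have hw0 : ∀ k, 0 ≤ w k := fun k =>
    mul_nonneg (mul_nonneg (Nat.cast_nonneg _) (pow_nonneg hx.1 _)) (pow_nonneg (sub_nonneg.2 hx.2) _)
  have hw1 : ∑ k, w k = 1 := sum_binomialWeight n x
  -- `k/n ∈ [0,1]` and is increasing in `k`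
  have hmem : ∀ k : Fin (n + 1), ((k : ℕ) : ℝ) / n ∈ Set.Icc (0 : ℝ) 1 := by
    intro k
    refine ⟨by positivity, ?_⟩
    rcases Nat.eq_zero_or_pos n with hn | hn
    · subst hn; simp
    · rw [div_le_one (by exact_mod_cast hn)]
      exact_mod_cast Nat.lt_succ_iff.1 k.isLt
  have hmono : ∀ k k' : Fin (n + 1), k ≤ k' → ((k : ℕ) : ℝ) / n ≤ ((k' : ℕ) : ℝ) / n := fun k k' hkk' =>
    div_le_div_of_nonneg_right (by exact_mod_cast hkk') (Nat.cast_nonneg n)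
  have hg0 : ∀ i k, 0 ≤ (![fun k => f₁ ((k : ℕ) / n), fun k => f₂ ((k : ℕ) / n), fun k => f₃ ((k : ℕ) / n)] :
      Fin 3 → Fin (n + 1) → ℝ) i k := by
    intro i k
    fin_cases i
    · exact h₁ _ (hmem k)
    · exact h₂ _ (hmem k)
    · exact h₃ _ (hmem k)
  have hgm : ∀ i, Monotone ((![fun k => f₁ ((k : ℕ) / n), fun k => f₂ ((k : ℕ) / n),
      fun k => f₃ ((k : ℕ) / n)] : Fin 3 → Fin (n + 1) → ℝ) i) := by
    intro i k k' hkk'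
    fin_cases i
    · exact hm₁ (hmem k) (hmem k') (hmono k k' hkk')
    · exact hm₂ (hmem k) (hmem k') (hmono k k' hkk')
    · exact hm₃ (hmem k) (hmem k') (hmono k k' hkk')
  have h := sahiPositive_of_linearOrder hw0 hw1 3 _ hg0 hgm
  -- `E₃` of the sampled functions under the binomial weight is the display (5.1)
  have key : sahiE w 3 ![fun k => f₁ ((k : ℕ) / n), fun k => f₂ ((k : ℕ) / n), fun k => f₃ ((k : ℕ) / n)] =
      2 * bernsteinPoly n (f₁ * f₂ * f₃) x
        + bernsteinPoly n f₁ x * bernsteinPoly n f₂ x * bernsteinPoly n f₃ x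
        - (bernsteinPoly n f₁ x * bernsteinPoly n (f₂ * f₃) x + bernsteinPoly n f₂ x * bernsteinPoly n (f₁ * f₃) x
            + bernsteinPoly n f₃ x * bernsteinPoly n (f₁ * f₂) x) := by
    rw [sahiE_three]
    rfl
  rw [key] at h
  linarith

/-! ### Proposition 5.3 — the display (5.4) IS `2^{3n} E₃` under the uniform measure (status: `C₃`, open) -/

/-- `⟨1_X⟩` under the constant weight `c`: `Σ_a c · 1_X(a) = c · card X`. [folklore] -/
private theorem ex_const_setInd {α : Type*} [Fintype α] [DecidableEq α] (c : ℝ) (X : Finset α) :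
    ex (fun _ : α => c) (setInd X) = c * X.card := by
  rw [ex_def]
  simp only [setInd_apply, mul_ite, mul_one, mul_zero]
  rw [Finset.sum_ite_mem, Finset.univ_inter, Finset.sum_const, nsmul_eq_mul, mul_comm]

/-- **Richards 2004, Proposition 5.3 — what the display (5.4) is.**  For ANY families `U₁, U₂, L` of subsets of
an `n`-set `A` (no closure hypotheses are needed for the identity), with `µ` the uniform weight `2^{-n}` on `2^A`
and `f₁ = 1_{U₁}`, `f₂ = 1_{U₂}`, `f₃ = 1_{L^c}`:
`2^{2n} card(U₁∩U₂) − 2^{2n+1} card(U₁∩U₂∩L) + 2^n(card(U₁∩U₂)card L + card(U₁∩L)card U₂ + card U₁ card(U₂∩L))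
 − 2^n card U₁ card U₂ − card U₁ card U₂ card L = 2^{3n} · E₃^{µ}(f₁,f₂,f₃)`.
Consequently Prop. 5.3 (the left side is `≥ 0` whenever `U₁, U₂` are closed above and `L` closed below) is,
verbatim, Sahi's `E₃ ≥ 0` for three increasing events under the UNIFORM measure on `2^A` — Kahn's Conjecture 5 for
fair coins (Gladkov–Zimin Conj. 2.6) — OPEN in print; its printed proof applies Theorem 1.1.  Nothing here asserts
it. [cite: Richards2004, Prop. 5.3 and eq. (5.4) (p. 1532); Kahn2022, Conj. 5 (p. 3)] -/
theorem richards2004_display54_eq {A : Type*} [Fintype A] [DecidableEq A] (U₁ U₂ L : Finset (Finset A)) :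
    (2 : ℝ) ^ (2 * Fintype.card A) * (U₁ ∩ U₂).card
        - 2 ^ (2 * Fintype.card A + 1) * (U₁ ∩ U₂ ∩ L).card
        + 2 ^ Fintype.card A * ((U₁ ∩ U₂).card * L.card + (U₁ ∩ L).card * U₂.card + U₁.card * (U₂ ∩ L).card)
        - 2 ^ Fintype.card A * (U₁.card * U₂.card) - U₁.card * U₂.card * L.card =
      2 ^ (3 * Fintype.card A) *
        sahiE (fun _ : Finset A => (1 : ℝ) / 2 ^ Fintype.card A) 3 ![setInd U₁, setInd U₂, setInd Lᶜ] := by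
  set N : ℕ := Fintype.card A with hN
  set c : ℝ := (1 : ℝ) / 2 ^ N with hc
  rw [sahiE_three]
  simp only [setInd_mul, ex_const_setInd]
  -- cardinalities of the intersections with the complement
  have hU : (Finset.univ : Finset (Finset A)).card = 2 ^ N := by
    rw [Finset.card_univ, Fintype.card_finset]
  have c1 : ((U₁ ∩ U₂ ∩ Lᶜ).card : ℝ) = (U₁ ∩ U₂).card - (U₁ ∩ U₂ ∩ L).card := by
    have := Finset.card_sdiff_add_card_inter (U₁ ∩ U₂) L
    rw [show U₁ ∩ U₂ ∩ Lᶜ = (U₁ ∩ U₂) \ L by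
      ext s; simp [Finset.mem_sdiff, Finset.mem_inter, and_assoc]]
    have h' : ((U₁ ∩ U₂) \ L).card + (U₁ ∩ U₂ ∩ L).card = (U₁ ∩ U₂).card := this
    have h'' : (((U₁ ∩ U₂) \ L).card : ℝ) + ((U₁ ∩ U₂ ∩ L).card : ℝ) = (U₁ ∩ U₂).card := by exact_mod_cast h'
    linarith
  have c2 : ((U₁ ∩ Lᶜ).card : ℝ) = U₁.card - (U₁ ∩ L).card := by
    have h' : (U₁ \ L).card + (U₁ ∩ L).card = U₁.card := Finset.card_sdiff_add_card_inter U₁ L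
    rw [show U₁ ∩ Lᶜ = U₁ \ L by ext s; simp [Finset.mem_sdiff, Finset.mem_inter]]
    have h'' : ((U₁ \ L).card : ℝ) + ((U₁ ∩ L).card : ℝ) = U₁.card := by exact_mod_cast h'
    linarith
  have c3 : ((U₂ ∩ Lᶜ).card : ℝ) = U₂.card - (U₂ ∩ L).card := by
    have h' : (U₂ \ L).card + (U₂ ∩ L).card = U₂.card := Finset.card_sdiff_add_card_inter U₂ L
    rw [show U₂ ∩ Lᶜ = U₂ \ L by ext s; simp [Finset.mem_sdiff, Finset.mem_inter]]
    have h'' : ((U₂ \ L).card : ℝ) + ((U₂ ∩ L).card : ℝ) = U₂.card := by exact_mod_cast h'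
    linarith
  have c4 : ((Lᶜ : Finset (Finset A)).card : ℝ) = 2 ^ N - L.card := by
    have h' := Finset.card_compl L
    rw [Fintype.card_finset] at h'
    have hle : L.card ≤ 2 ^ Fintype.card A := by
      calc L.card ≤ (Finset.univ : Finset (Finset A)).card := Finset.card_le_univ L
        _ = 2 ^ Fintype.card A := by rw [Finset.card_univ, Fintype.card_finset]
    rw [h', Nat.cast_sub hle]
    push_cast
    rfl
  rw [c1, c2, c3, c4]
  have h2 : (2 : ℝ) ^ N ≠ 0 := pow_ne_zero _ two_ne_zero
  rw [hc]
  field_simp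
  ring

end Richards2004

end Literature.Combinatorics.Sahi2008

end
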